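import Literature.Computability.Cryptography.VanDamSeroussiEigenstate
import Literature.NumberTheory.EllipticCurves.HalfIntegralWeightFormsGaussSumProofs
import Mathlib.NumberTheory.LegendreSymbol.QuadraticChar.Basic
import HarnessLib

/-!
# van Dam–Seroussi: the quadratic character as a reference branch with a known Gauss-sum phase

Topic `Literature/Computability/Cryptography`, companion of `VanDamSeroussiGaussSums.lean` (the named
fact `VanDamSeroussi2002_gaussSumPhase_qsolvable`) and `VanDamSeroussiEigenstate.lean` (Algorithm 1).
[VanDamSeroussi2002, §2.2]: "Unlike the case of general characters, the Gauss sums of such quadratic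
characters are known completely: `G(𝔽_{p^r}, χ, 1) = −(−1)^r √(p^r)` if `p ≡ 1 (mod 4)`, and
`−(−i)^r √(p^r)` if `p ≡ 3 (mod 4)`" (for `r = 1`: `√p`, resp. `i√p` — Gauss's sign theorem). In the
tree's planned realisation of Thm. 1 (NOTES of the `provefact` unit) the phase `γ` of `G(χ_a, e_b)` is
read RELATIVE to a reference branch that runs the same circuit with the exponent `a` replaced by
`(p−1)/2`, i.e. with the quadratic character `η`, whose eigenvalue `G(η, e_b)/√p = η(b) ε_p`,
`ε_p ∈ {1, i}`, is classically known. This file PROVES the number theory of that branch: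

* `exp_quadratic_exponent` — `e(((p−1)/2)/(p−1)) = −1` for an odd prime `p`: the exponent
  `α = (p−1)/2` of the triple `(p, g, α)` gives `χ(g) = −1`;
* `isSquare_iff_of_isPrimitiveRoot` / `quadCharC_primitiveRoot` — a primitive root is a
  non-residue: `η(g) = −1` for `η = quadCharC p` (the tree's complex-valued quadratic character,
  `EllipticCurves/HalfIntegralWeightFormsGaussSumProofs.lean`);
* **`mulChar_eq_quadCharC`** — the multiplicative character with `χ(g) = −1` at a primitive root `g`
  IS `η` (characters of the cyclic group `𝔽_p^×` are determined at a generator);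
* **`gaussSum_quadCharC_mulShift`** — `G(η, e_b) = η(b) · ε_p · √p` for `b ≠ 0`, with
  `ε_p = thetaEps p` (`1` if `p ≡ 1`, `i` if `p ≡ 3 (mod 4)`), from Fact 1
  (`VanDamSeroussi.gaussSum_mulShift_eq_inv_mul`) and the tree's PROVED sign theorem
  `legendreGaussSum_eq`; hence the reference eigenvalue `G(η, e_b)/√p = η(b) ε_p`
  (`gaussSum_quadCharC_mulShift_div_sqrt`), a fourth root of unity.

Everything here is proved; no definition and no named fact is introduced.

## References

* W. van Dam, G. Seroussi, arXiv:quant-ph/0207131 (2002), §2.1 (characters `(p^r, g, α)`), §2.2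
  (quadratic characters and their Gauss sums), §4 Thm. 1 [VanDamSeroussi2002].
* K. Ireland, M. Rosen, *A Classical Introduction to Modern Number Theory*, GTM 84, Ch. 6 §4 Thm. 1
  (the sign of the quadratic Gauss sum) [IrelandRosen1990].
-/

noncomputable section

namespace Literature.Computability.Cryptography

namespace VanDamSeroussi

open Complex Literature.NumberTheory.EllipticCurves.ModularForms

variable {p : ℕ} [hp : Fact p.Prime]

/-- **The exponent of the quadratic character**: for an odd prime `p`,
`exp(2πi · ((p−1)/2) / (p−1)) = −1`. [cite: VanDamSeroussi2002, §2.2 (χ(g^j) = (−1)^j)] -/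
theorem exp_quadratic_exponent (hp2 : p ≠ 2) :
    Complex.exp (2 * Real.pi * Complex.I * (((p - 1) / 2 : ℕ) : ℂ) / ((p : ℂ) - 1)) = -1 := by
  have hodd : Odd p := hp.out.odd_of_ne_two hp2
  obtain ⟨m, hm⟩ : ∃ m, p = 2 * m + 1 := hodd
  have hm1 : 1 ≤ m := by
    have := hp.out.two_le; omega
  have h1 : (p - 1) / 2 = m := by omega
  have h2 : ((p : ℂ) - 1) = 2 * m := by
    have : (p : ℂ) = ((2 * m + 1 : ℕ) : ℂ) := by rw [hm]
    rw [this]; push_cast; ring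
  rw [h1, h2]
  have hm0 : (m : ℂ) ≠ 0 := by exact_mod_cast (by omega : m ≠ 0)
  have : 2 * (Real.pi : ℂ) * Complex.I * (m : ℂ) / (2 * m) = Real.pi * Complex.I := by
    field_simp
  rw [this, Complex.exp_pi_mul_I]

/-- A primitive root `g` modulo an odd prime is not a square (else `g^{(p−1)/2} = 1`).
[cite: IrelandRosen1990, Ch. 4 §1 (primitive roots) and Prop. 5.1.2] -/
theorem not_isSquare_of_isPrimitiveRoot (hp2 : p ≠ 2) {g : ZMod p} (hg : IsPrimitiveRoot g (p - 1)) :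
    ¬ IsSquare g := by
  have hp1 : 2 ≤ p := hp.out.two_le
  have hg0 : g ≠ 0 := by
    intro h0
    have := hg.pow_eq_one
    rw [h0, zero_pow (by omega)] at this
    exact zero_ne_one this
  intro hsq
  have h1 : g ^ (p / 2) = 1 := (ZMod.euler_criterion p hg0).1 hsq
  have h2 : (p - 1) ∣ p / 2 := (hg.pow_eq_one_iff_dvd _).1 h1
  have h3 : 0 < p / 2 := Nat.div_pos hp1 two_pos
  have h4 : p / 2 < p - 1 := by
    have hodd : Odd p := hp.out.odd_of_ne_two hp2
    obtain ⟨m, hm⟩ := hodd; omega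
  exact absurd (Nat.le_of_dvd h3 h2) (not_le.2 h4)

/-- `η(g) = −1` for a primitive root `g` and the quadratic character `η = quadCharC p`.
[cite: VanDamSeroussi2002, §2.2 (χ(g^j) = (−1)^j)] -/
theorem quadCharC_primitiveRoot (hp2 : p ≠ 2) {g : ZMod p} (hg : IsPrimitiveRoot g (p - 1)) :
    quadCharC p g = -1 := by
  rw [quadCharC_apply, (quadraticChar_neg_one_iff_not_isSquare).2 (not_isSquare_of_isPrimitiveRoot hp2 hg)]
  push_cast
  rfl

/-- Every unit of `ZMod p` is a power of a primitive root. [folklore] -/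
theorem exists_pow_eq_of_isPrimitiveRoot {g : ZMod p} (hg : IsPrimitiveRoot g (p - 1)) {x : ZMod p}
    (hx : x ≠ 0) : ∃ j : ℕ, g ^ j = x := by
  haveI : NeZero (p - 1) := ⟨by have := hp.out.two_le; omega⟩
  obtain ⟨j, -, hj⟩ := hg.eq_pow_of_pow_eq_one (ZMod.pow_card_sub_one_eq_one hx)
  exact ⟨j, hj⟩

/-- **A character of `𝔽_p^×` with `χ(g) = −1` at a primitive root `g` is the quadratic character.**
(Multiplicative characters of the cyclic group `𝔽_p^×` are determined by their value at a generator;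
the triple `(p, g, (p−1)/2)` of [VanDamSeroussi2002, §2.1] thus names `η`.)
[cite: VanDamSeroussi2002, §2.1–2.2 (χ(g^j) = ζ^{αj}; quadratic characters χ(g^j) = (−1)^j)] -/
theorem mulChar_eq_quadCharC (hp2 : p ≠ 2) {g : ZMod p} (hg : IsPrimitiveRoot g (p - 1))
    {χ : MulChar (ZMod p) ℂ} (hχ : χ g = -1) : χ = quadCharC p := by
  have hη := quadCharC_primitiveRoot hp2 hg
  apply MulChar.ext
  intro u
  obtain ⟨j, hj⟩ := exists_pow_eq_of_isPrimitiveRoot hg (Units.ne_zero u)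
  rw [← hj, map_pow, map_pow, hχ, hη]

/-- The quadratic character takes the values `±1` on units, so it is its own inverse there.
[folklore] -/
theorem quadCharC_inv_apply (b : ZMod p) : (quadCharC p)⁻¹ b = quadCharC p b := by
  by_cases hb : IsUnit b
  · rw [MulChar.inv_apply_eq_inv']
    have hb0 : b ≠ 0 := hb.ne_zero
    have h2 : quadCharC p b ^ 2 = 1 := quadCharC_sq_eq_one hb0
    exact inv_eq_of_mul_eq_one_right (by rw [← sq]; exact h2)
  · rw [MulChar.map_nonunit _ hb, MulChar.map_nonunit _ hb]

/-- **The Gauss sum of the quadratic character with a twist** [VanDamSeroussi2002, §2.2 with §2.1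
Fact 1]: `G(η, e_b) = η(b) · ε_p · √p` for `b ≠ 0`, `ε_p = 1` (`p ≡ 1 mod 4`) or `i`
(`p ≡ 3 mod 4`) — Gauss's sign theorem (`legendreGaussSum_eq`, proved in the tree) transported by
Fact 1. [cite: VanDamSeroussi2002, §2.2 (quadratic Gauss sums are known completely)] -/
theorem gaussSum_quadCharC_mulShift (hp2 : p ≠ 2) (b : ZMod p) :
    gaussSum (quadCharC p) (ZMod.stdAddChar.mulShift b) =
      quadCharC p b * (thetaEps p * (Real.sqrt p : ℂ)) := by
  rw [gaussSum_mulShift_eq_inv_mul (quadCharC_ne_one hp2), quadCharC_inv_apply]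
  congr 1
  exact legendreGaussSum_eq hp2

/-- **The reference eigenvalue**: `G(η, e_b)/√p = η(b) · ε_p` for `b ≠ 0` — a known fourth root of
unity (`η(b)` is the Legendre symbol of `b`, computable by Euler's criterion; `ε_p` depends on
`p mod 4`). [cite: VanDamSeroussi2002, §2.2 and §4 Algorithm 1 (eigenvalue G/√(p^r))] -/
theorem gaussSum_quadCharC_mulShift_div_sqrt (hp2 : p ≠ 2) (b : ZMod p) :
    gaussSum (quadCharC p) (ZMod.stdAddChar.mulShift b) / (Real.sqrt p : ℂ) = quadCharC p b * thetaEps p := by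
  have hs : (Real.sqrt p : ℂ) ≠ 0 := by
    exact_mod_cast (Real.sqrt_pos.2 (by exact_mod_cast hp.out.pos)).ne'
  rw [gaussSum_quadCharC_mulShift hp2, div_eq_iff hs, mul_assoc]

/-- `ε_p⁴ = 1`: the reference phase is a fourth root of unity (`ε_p ∈ {1, i}`). [folklore] -/
theorem thetaEps_pow_four (d : ℤ) : thetaEps d ^ 4 = 1 := by
  unfold thetaEps
  split_ifs
  · rw [show (4 : ℕ) = 2 * 2 by norm_num, pow_mul, Complex.I_sq]; norm_num
  · exact one_pow 4

end VanDamSeroussi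

end Literature.Computability.Cryptography

end
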